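import Summits.CriticalPhenomena.PercolationContinuityZ3.Theorems.Transplant.PlanarSkeletonFrmScaledDefs
import Mathlib.Combinatorics.SimpleGraph.Cayley
import HarnessLib

/-!
# EXACTNESS OF THE WALL AT THE CAYLEY LEVEL (kernel): a chart on `Γ` translated by EVERY LEFT MULTIPLICATION and admitting two exact `N`-steps
# yields two INDEPENDENT characters — so on a wall group (`b₁ ≤ 1`) every one-type scaled skeleton of a Cayley graph must use frames outside `Γ_L`

builds on p205010 (kernel theorem, internal audit signed; external expert review pending) — nothing in this file uses p205010; unconditional, no node.
Lane `prim-bschramm`, seat `prim-bschramm-p4` gen 24 (PART C3 of `P4-GENERAL.md` §46; the R-level remark §45.6 made kernel).  Helper file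
(`--supports stmt-CriticalPhenomena-4575 --as helper`).

THE POINT ("be exact about what remains").  The conditional theorem of record (`CayleyScaled.criticalContinuity_of_rank`, `AutScaled.criticalContinuity`)
builds, from a rank-2 homomorphism `Γ → ℤ²`, a ONE-type scaled skeleton on `Cay(Γ;S)` whose frames are the LEFT translations.  Conversely:
* **`LeftChart.exists_independent_characters`** — if `φ : Γ → ℤ²` is translated by every left multiplication (`φ(g w) = φ w + (φ(g t) − φ t)`) and
  two values `φ v₀ − φ t = N e₀`, `φ v₁ − φ t = N e₁` (`N ≠ 0`) occur, then `c(g) := φ(g t) − φ t` is a homomorphism with `c(v₀ t⁻¹) = N e₀`,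
  `c(v₁ t⁻¹) = N e₁`: TWO INDEPENDENT CHARACTERS (`b₁(Γ) ≥ 2` in the tree's sense);
* **`LeftChart.exists_independent_characters_of_frmScaled`** — in particular for every `PlanarSkeletonFrmScaled` structure on `Cay(Γ;S)` with a base
  vertex `t` whose chart is translated by all left multiplications (its exact `N`-steps at `t` supply `v₀, v₁`);
* **`LeftChart.no_leftChart_of_wall`** — hence on a WALL group (all characters pairwise dependent — the hypothesis `hwall` of
  `Wall.conj4_cayley_of_frmScaledNode₁_of_wall`) NO such chart exists, for ANY `S`: a one-type frames-only structure on a wall group's Cayley graph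
  must use automorphisms outside `Γ_L` (absent for GRR generating sets), which is why the wall needs the planners' multi-type / twisted node.
So among one-type scaled skeletons with left-translation frames the input `b₁(Γ) ≥ 2` of the conditional theorem is OPTIMAL.  Pure algebra; def-free.
[cite: BenjaminiSchramm1996, Conj. 4; §2 (Cayley graphs)] [cite: KozmaNitzan2024, §4 p. 16 (Lemma 8: the role of the lattice symmetries)]
-/

noncomputable section

namespace Summit.CriticalPhenomena.PercolationContinuityZ3.Theorems.Transplant

open SimpleGraph Literature.Probability.LatticeModels
open scoped Classical

namespace LeftChart

variable {Γ : Type} [Group Γ]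

/-- **The character of a left-translated chart**: `c(g) := φ(g t) − φ t` is additive, `c(g h) = c g + c h`. [folklore] -/
theorem charFun_mul (φ : Γ → Site 2) (t : Γ) (hleft : ∀ g w : Γ, φ (g * w) = φ w + (φ (g * t) - φ t)) (g h : Γ) :
    φ (g * h * t) - φ t = (φ (g * t) - φ t) + (φ (h * t) - φ t) := by
  rw [mul_assoc, hleft g (h * t)]; abel

/-- The `i`-th coordinate character `g ↦ (φ(g t) − φ t) i` as a homomorphism `Γ →* Multiplicative ℤ`. [folklore] -/
theorem exists_char (φ : Γ → Site 2) (t : Γ) (hleft : ∀ g w : Γ, φ (g * w) = φ w + (φ (g * t) - φ t)) (i : Fin 2) :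
    ∃ ψ : Γ →* Multiplicative ℤ, ∀ g, Multiplicative.toAdd (ψ g) = (φ (g * t) - φ t) i := by
  refine ⟨{ toFun := fun g => Multiplicative.ofAdd ((φ (g * t) - φ t) i), map_one' := by simp, map_mul' := fun g h => ?_ }, fun g => rfl⟩
  rw [← ofAdd_add, charFun_mul φ t hleft g h, Pi.add_apply]

/-- **THEOREM (exactness of the wall, chart level): a chart translated by EVERY left multiplication with two exact `N`-steps (`N ≠ 0`) gives two
INDEPENDENT characters of `Γ`.** [cite: BenjaminiSchramm1996, §2 (Cayley graphs); Conj. 4] -/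
theorem exists_independent_characters (φ : Γ → Site 2) (t : Γ) (hleft : ∀ g w : Γ, φ (g * w) = φ w + (φ (g * t) - φ t)) {N : ℤ} (hN : N ≠ 0)
    (hstep : ∀ i : Fin 2, ∃ v : Γ, φ v = φ t + Pi.single i N) :
    ∃ (ψ₀ ψ₁ : Γ →* Multiplicative ℤ) (a b : Γ),
      Multiplicative.toAdd (ψ₀ a) * Multiplicative.toAdd (ψ₁ b) ≠ Multiplicative.toAdd (ψ₁ a) * Multiplicative.toAdd (ψ₀ b) := by
  obtain ⟨ψ₀, hψ₀⟩ := exists_char φ t hleft 0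
  obtain ⟨ψ₁, hψ₁⟩ := exists_char φ t hleft 1
  obtain ⟨v₀, hv₀⟩ := hstep 0
  obtain ⟨v₁, hv₁⟩ := hstep 1
  refine ⟨ψ₀, ψ₁, v₀ * t⁻¹, v₁ * t⁻¹, ?_⟩
  have h0 : φ (v₀ * t⁻¹ * t) - φ t = Pi.single (0 : Fin 2) N := by rw [inv_mul_cancel_right, hv₀, add_sub_cancel_left]
  have h1 : φ (v₁ * t⁻¹ * t) - φ t = Pi.single (1 : Fin 2) N := by rw [inv_mul_cancel_right, hv₁, add_sub_cancel_left]
  rw [hψ₀, hψ₁, hψ₀, hψ₁, h0, h1]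
  simp [hN]

/-- **Skeleton form**: a `PlanarSkeletonFrmScaled` structure on `Cay(Γ;S)` with a base vertex `t` whose chart is translated by all left
multiplications gives two independent characters (the exact `N`-steps at `t` supply the two values). [cite: BenjaminiSchramm1996, §2; Conj. 4]
[cite: KozmaNitzan2024, §4 p. 16 (Lemma 8)] -/
theorem exists_independent_characters_of_frmScaled (S : Finset Γ) [(mulCayley (↑S : Set Γ)).LocallyFinite]
    (Φ : PlanarSkeletonFrmScaled (mulCayley (↑S : Set Γ))) (t : Γ) (hleft : ∀ g w : Γ, Φ.φ (g * w) = Φ.φ w + (Φ.φ (g * t) - Φ.φ t)) :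
    ∃ (ψ₀ ψ₁ : Γ →* Multiplicative ℤ) (a b : Γ),
      Multiplicative.toAdd (ψ₀ a) * Multiplicative.toAdd (ψ₁ b) ≠ Multiplicative.toAdd (ψ₁ a) * Multiplicative.toAdd (ψ₀ b) := by
  have hN : (Φ.N : ℤ) ≠ 0 := by have := Φ.one_le_N; omega
  refine exists_independent_characters Φ.φ t hleft hN fun i => ?_
  obtain ⟨v, -, hv⟩ := Φ.step t i 1
  exact ⟨v, by rw [hv, Units.val_one, mul_one]⟩

/-- **THE WALL IS EXACT for left-translation frames**: if all characters of `Γ` are pairwise dependent (the WALL hypothesis of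
`Wall.conj4_cayley_of_frmScaledNode₁_of_wall`), then NO chart on `Γ` is translated by every left multiplication with two exact `N`-steps, `N ≠ 0` —
for any generating set whatsoever. [cite: BenjaminiSchramm1996, Conj. 4; §2 (Cayley graphs)] -/
theorem no_leftChart_of_wall
    (hwall : ∀ (ψ₀ ψ₁ : Γ →* Multiplicative ℤ) (a b : Γ),
      Multiplicative.toAdd (ψ₀ a) * Multiplicative.toAdd (ψ₁ b) = Multiplicative.toAdd (ψ₁ a) * Multiplicative.toAdd (ψ₀ b))
    (φ : Γ → Site 2) (t : Γ) (hleft : ∀ g w : Γ, φ (g * w) = φ w + (φ (g * t) - φ t)) {N : ℤ} (hN : N ≠ 0) :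
    ¬ ∀ i : Fin 2, ∃ v : Γ, φ v = φ t + Pi.single i N := by
  intro hstep
  obtain ⟨ψ₀, ψ₁, a, b, hne⟩ := exists_independent_characters φ t hleft hN hstep
  exact hne (hwall ψ₀ ψ₁ a b)

/-- Skeleton form of the no-go: on a wall group no `PlanarSkeletonFrmScaled` structure on any `Cay(Γ;S)` has its chart translated by all left
multiplications (relative to any base vertex `t`). [cite: BenjaminiSchramm1996, Conj. 4; §2 (Cayley graphs)] -/
theorem no_leftFrames_frmScaled_of_wall
    (hwall : ∀ (ψ₀ ψ₁ : Γ →* Multiplicative ℤ) (a b : Γ),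
      Multiplicative.toAdd (ψ₀ a) * Multiplicative.toAdd (ψ₁ b) = Multiplicative.toAdd (ψ₁ a) * Multiplicative.toAdd (ψ₀ b))
    (S : Finset Γ) [(mulCayley (↑S : Set Γ)).LocallyFinite] (Φ : PlanarSkeletonFrmScaled (mulCayley (↑S : Set Γ))) (t : Γ) :
    ¬ ∀ g w : Γ, Φ.φ (g * w) = Φ.φ w + (Φ.φ (g * t) - Φ.φ t) := by
  intro hleft
  obtain ⟨ψ₀, ψ₁, a, b, hne⟩ := exists_independent_characters_of_frmScaled S Φ t hleft
  exact hne (hwall ψ₀ ψ₁ a b)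

end LeftChart

/-! ## §2 The same for ACTIONS: frames given by a group `A` acting by automorphisms force `b₁(A) ≥ 2` (optimality of `AutScaled.criticalContinuity`'s input) -/

namespace ActionChart

variable {V : Type} {A : Type} [Group A] [MulAction A V]

/-- **The character of an `A`-translated chart**: `c(a) := φ(a • t) − φ t` is additive. [folklore] -/
theorem charFun_mul (φ : V → Site 2) (t : V) (hact : ∀ (a : A) (w : V), φ (a • w) = φ w + (φ (a • t) - φ t)) (a b : A) :
    φ ((a * b) • t) - φ t = (φ (a • t) - φ t) + (φ (b • t) - φ t) := by
  rw [mul_smul, hact a (b • t)]; abel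

/-- The `i`-th coordinate character `a ↦ (φ(a • t) − φ t) i` as a homomorphism `A →* Multiplicative ℤ`. [folklore] -/
theorem exists_char (φ : V → Site 2) (t : V) (hact : ∀ (a : A) (w : V), φ (a • w) = φ w + (φ (a • t) - φ t)) (i : Fin 2) :
    ∃ ψ : A →* Multiplicative ℤ, ∀ a, Multiplicative.toAdd (ψ a) = (φ (a • t) - φ t) i := by
  refine ⟨{ toFun := fun a => Multiplicative.ofAdd ((φ (a • t) - φ t) i), map_one' := by simp, map_mul' := fun a b => ?_ }, fun a => rfl⟩
  rw [← ofAdd_add, charFun_mul φ t hact a b, Pi.add_apply]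

/-- **THEOREM (exactness at the level of actions): if a chart `φ : V → ℤ²` is translated by EVERY element of a group `A` acting on `V`
(`φ(a • w) = φ w + (φ(a • t) − φ t)`) and the two values `φ t + N e₀`, `φ t + N e₁` (`N ≠ 0`) are attained ON THE ORBIT `A • t`, then `A` has two
INDEPENDENT characters** — the input `b₁(A) ≥ 2` of `AutScaled.criticalContinuity` is optimal among one-type scaled skeletons whose frames come from
`A` (for a TRANSITIVE `A` every value is attained on the orbit, so the exact `N`-steps at `t` suffice: `…_of_transitive`).
[cite: BenjaminiSchramm1996, §2 (almost transitive graphs); Conj. 4] -/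
theorem exists_independent_characters (φ : V → Site 2) (t : V) (hact : ∀ (a : A) (w : V), φ (a • w) = φ w + (φ (a • t) - φ t)) {N : ℤ}
    (hN : N ≠ 0) (hstep : ∀ i : Fin 2, ∃ a : A, φ (a • t) = φ t + Pi.single i N) :
    ∃ (ψ₀ ψ₁ : A →* Multiplicative ℤ) (a b : A),
      Multiplicative.toAdd (ψ₀ a) * Multiplicative.toAdd (ψ₁ b) ≠ Multiplicative.toAdd (ψ₁ a) * Multiplicative.toAdd (ψ₀ b) := by
  obtain ⟨ψ₀, hψ₀⟩ := exists_char φ t hact 0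
  obtain ⟨ψ₁, hψ₁⟩ := exists_char φ t hact 1
  obtain ⟨a₀, ha₀⟩ := hstep 0
  obtain ⟨a₁, ha₁⟩ := hstep 1
  refine ⟨ψ₀, ψ₁, a₀, a₁, ?_⟩
  have h0 : φ (a₀ • t) - φ t = Pi.single (0 : Fin 2) N := by rw [ha₀, add_sub_cancel_left]
  have h1 : φ (a₁ • t) - φ t = Pi.single (1 : Fin 2) N := by rw [ha₁, add_sub_cancel_left]
  rw [hψ₀, hψ₁, hψ₀, hψ₁, h0, h1]
  simp [hN]

/-- **Transitive actions**: a chart translated by every element of a TRANSITIVE group `A`, with two exact `N`-steps anywhere (`N ≠ 0`), gives two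
independent characters of `A`. [cite: BenjaminiSchramm1996, §2 (almost transitive graphs); Conj. 4] -/
theorem exists_independent_characters_of_transitive (φ : V → Site 2) (t : V) (htr : ∀ v : V, ∃ a : A, a • t = v)
    (hact : ∀ (a : A) (w : V), φ (a • w) = φ w + (φ (a • t) - φ t)) {N : ℤ} (hN : N ≠ 0)
    (hstep : ∀ i : Fin 2, ∃ v : V, φ v = φ t + Pi.single i N) :
    ∃ (ψ₀ ψ₁ : A →* Multiplicative ℤ) (a b : A),
      Multiplicative.toAdd (ψ₀ a) * Multiplicative.toAdd (ψ₁ b) ≠ Multiplicative.toAdd (ψ₁ a) * Multiplicative.toAdd (ψ₀ b) := by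
  refine exists_independent_characters φ t hact hN fun i => ?_
  obtain ⟨v, hv⟩ := hstep i
  obtain ⟨a, rfl⟩ := htr v
  exact ⟨a, hv⟩

/-- **Skeleton form for actions**: a `PlanarSkeletonFrmScaled` structure on `G` with base vertex `t` whose chart is translated by every element of a
transitive group `A` acting on `V` gives two independent characters of `A`. [cite: BenjaminiSchramm1996, §2; Conj. 4] [cite: KozmaNitzan2024, §4 p. 16 (Lemma 8)] -/
theorem exists_independent_characters_of_frmScaled {G : SimpleGraph V} [G.LocallyFinite] (Φ : PlanarSkeletonFrmScaled G) (t : V)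
    (htr : ∀ v : V, ∃ a : A, a • t = v) (hact : ∀ (a : A) (w : V), Φ.φ (a • w) = Φ.φ w + (Φ.φ (a • t) - Φ.φ t)) :
    ∃ (ψ₀ ψ₁ : A →* Multiplicative ℤ) (a b : A),
      Multiplicative.toAdd (ψ₀ a) * Multiplicative.toAdd (ψ₁ b) ≠ Multiplicative.toAdd (ψ₁ a) * Multiplicative.toAdd (ψ₀ b) := by
  have hN : (Φ.N : ℤ) ≠ 0 := by have := Φ.one_le_N; omega
  refine exists_independent_characters_of_transitive Φ.φ t htr hact hN fun i => ?_
  obtain ⟨v, -, hv⟩ := Φ.step t i 1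
  exact ⟨v, by rw [hv, Units.val_one, mul_one]⟩

/-- **THE WALL IS EXACT for action frames**: if all characters of the TRANSITIVE acting group `A` are pairwise dependent (the wall hypothesis of
`Wall.conj4_transitive_of_frmScaledNode₁_of_wall`), NO `PlanarSkeletonFrmScaled` structure on `G` has its chart translated by every element of `A`.
[cite: BenjaminiSchramm1996, Conj. 4; §2 (almost transitive graphs)] -/
theorem no_actionFrames_frmScaled_of_wall {G : SimpleGraph V} [G.LocallyFinite]
    (hwall : ∀ (ψ₀ ψ₁ : A →* Multiplicative ℤ) (a b : A),
      Multiplicative.toAdd (ψ₀ a) * Multiplicative.toAdd (ψ₁ b) = Multiplicative.toAdd (ψ₁ a) * Multiplicative.toAdd (ψ₀ b))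
    (Φ : PlanarSkeletonFrmScaled G) (t : V) (htr : ∀ v : V, ∃ a : A, a • t = v) :
    ¬ ∀ (a : A) (w : V), Φ.φ (a • w) = Φ.φ w + (Φ.φ (a • t) - Φ.φ t) := by
  intro hact
  obtain ⟨ψ₀, ψ₁, a, b, hne⟩ := exists_independent_characters_of_frmScaled Φ t htr hact
  exact hne (hwall ψ₀ ψ₁ a b)

end ActionChart

/-! ## §3 Torsion groups are wall groups: all characters vanish (the intermediate-growth residual (e′) is outside every `Γ_L`-framed one-type structure) -/

namespace LeftChart

variable {Γ : Type} [Group Γ]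

/-- **Every character of a torsion group is trivial** (`g^n = 1 ⟹ n • ψ(g) = 0` in the torsion-free `ℤ`). [folklore] -/
theorem toAdd_char_eq_zero_of_isTorsion (hΓ : Monoid.IsTorsion Γ) (ψ : Γ →* Multiplicative ℤ) (g : Γ) : Multiplicative.toAdd (ψ g) = 0 := by
  obtain ⟨n, hn, hg⟩ := (isOfFinOrder_iff_pow_eq_one.1 (hΓ g))
  have h : (ψ g) ^ n = 1 := by rw [← map_pow, hg, map_one]
  have h' : n • Multiplicative.toAdd (ψ g) = 0 := by
    have := congrArg Multiplicative.toAdd h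
    rwa [toAdd_pow, toAdd_one] at this
  rcases (smul_eq_zero.1 h') with h0 | h0
  · exact absurd h0 hn.ne'
  · exact h0

/-- **Torsion groups satisfy the wall hypothesis**: all characters are pairwise dependent (indeed zero). [folklore] -/
theorem characters_dependent_of_isTorsion (hΓ : Monoid.IsTorsion Γ) (ψ₀ ψ₁ : Γ →* Multiplicative ℤ) (a b : Γ) :
    Multiplicative.toAdd (ψ₀ a) * Multiplicative.toAdd (ψ₁ b) = Multiplicative.toAdd (ψ₁ a) * Multiplicative.toAdd (ψ₀ b) := by
  rw [toAdd_char_eq_zero_of_isTorsion hΓ ψ₀ a, toAdd_char_eq_zero_of_isTorsion hΓ ψ₁ a, zero_mul, zero_mul]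

/-- **No `Γ_L`-framed one-type scaled skeleton on any Cayley graph of a TORSION group** (e.g. the torsion groups of intermediate growth of the class
map's residual (e′)): the conclusion side for them lies outside every one-type structure framed by left translations — a precise form of "no chart
exists". [cite: BenjaminiSchramm1996, Conj. 4; §2 (Cayley graphs)] -/
theorem no_leftFrames_frmScaled_of_isTorsion (hΓ : Monoid.IsTorsion Γ) (S : Finset Γ) [(mulCayley (↑S : Set Γ)).LocallyFinite]
    (Φ : PlanarSkeletonFrmScaled (mulCayley (↑S : Set Γ))) (t : Γ) : ¬ ∀ g w : Γ, Φ.φ (g * w) = Φ.φ w + (Φ.φ (g * t) - Φ.φ t) :=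
  no_leftFrames_frmScaled_of_wall (characters_dependent_of_isTorsion hΓ) S Φ t

/-- Likewise no `Γ_L`-translated chart with two exact `N`-steps (`N ≠ 0`) exists on a torsion group. [cite: BenjaminiSchramm1996, Conj. 4; §2] -/
theorem no_leftChart_of_isTorsion (hΓ : Monoid.IsTorsion Γ) (φ : Γ → Site 2) (t : Γ) (hleft : ∀ g w : Γ, φ (g * w) = φ w + (φ (g * t) - φ t))
    {N : ℤ} (hN : N ≠ 0) : ¬ ∀ i : Fin 2, ∃ v : Γ, φ v = φ t + Pi.single i N :=
  no_leftChart_of_wall (characters_dependent_of_isTorsion hΓ) φ t hleft hN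

end LeftChart

end Summit.CriticalPhenomena.PercolationContinuityZ3.Theorems.Transplant

end
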